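import Literature.Topology.FourManifolds.NullhomotopicNormalFraming
import Literature.Topology.FourManifolds.ProjectiveLineRotationField
import Literature.Topology.FourManifolds.ImmersionOrientation
import Literature.Geometry.Manifold.InjOnLocalDiffeomorphInverse

/-!
# From a nowhere-zero normal section of an embedded sphere to a trivial-normal-bundle witness
(registered helper `helper_nwtEndgame` of line `cross-cap-laurent`, crux `GromovRecognitionRelEnd`,
item stmt-SmoothPoincare4-11009; endgame of the child stub `stub_normalWitnessTransfer` of the split
piece `AdjunctionEmbeddedSpheres`, stmt-SmoothPoincare4-16775)

Setting: `D : CodimTwoData 2 X ℂℙ¹ ℝᵐ`, an embedded sphere `b : ℂℙ¹ → X` in a `4`-manifold read in a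
Whitney embedding `e : X → ℝᵐ` (Literature/Topology/FourManifolds/EmbeddedSurfaceNormalPlane.lean), and a
CONTINUOUS nowhere-zero section `s₀` of its normal plane field (`Q y (s₀ y) = s₀ y ≠ 0`).  Claim: the
image `b(ℂℙ¹)` is cut out, in an open neighbourhood `N'`, by a smooth `ℂ`-valued submersion `π'`.
Proof (all inputs proved in the tree): the normal bundle of an embedded `ℂℙ¹` carries a rotation field
(`CodimTwoData.exists_isRotationField_projectiveLine`); smoothing the section
(`exists_contMDiff_normalSection_of_continuous`) and pairing it with its rotated partner gives a normal
framing smooth along `b` (`exists_isSmoothAlong_of_normalSection`), hence a framed tube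
`ν : ℂℙ¹ × ℝ² ↪ X` with open range and `ν (y, 0) = b y` (`exists_isSmoothEmbedding_tube_of_isSmoothAlong`,
Kosinski III (2.2)); `ν` is an injective local diffeomorphism (`4 = 2 + 2`), so its inverse is smooth on
the range with bijective differential (`contMDiffOn_invFunOn_of_bijective_mfderiv`,
`bijective_mfderiv_invFunOn`), and `π' := (ℝ² ≅ ℂ) ∘ pr₂ ∘ ν⁻¹` is the witness.  References: R. C. Kirby,
*The Topology of 4-Manifolds* (1989), Ch. VIII Thm. 2; A. Kosinski, *Differential Manifolds* (1993),
III (2.2)–(2.3).  No new definitions.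
-/

noncomputable section

open scoped Manifold ContDiff Topology
open Set Function Metric Literature.Topology.FourManifolds

set_option linter.dupNamespace false

namespace Summit.SmoothPoincare4.SmoothPoincare4.Theorems.GromovRecognitionRelEnd.CrossCapLaurent

namespace HelperNwtEndgame

/-- An injective linear map between real spaces of equal finite dimension `4` is bijective. [folklore] -/
theorem bijective_of_injective_four {E₁ E₂ : Type*} [AddCommGroup E₁] [Module ℝ E₁] [AddCommGroup E₂]
    [Module ℝ E₂] [FiniteDimensional ℝ E₁] [FiniteDimensional ℝ E₂]
    (h : Module.finrank ℝ E₁ = Module.finrank ℝ E₂) (L : E₁ →ₗ[ℝ] E₂) (hL : Injective L) :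
    Bijective L :=
  ⟨hL, (LinearMap.injective_iff_surjective_of_finrank_eq_finrank h).1 hL⟩

end HelperNwtEndgame

open HelperNwtEndgame

/-- **Endgame of the normal-witness transfer**: an embedded two-sphere `b : ℂℙ¹ → X` in a
`4`-manifold (read in a Whitney embedding, `D : CodimTwoData 2 X ℂℙ¹ ℝᵐ`) whose normal plane field has a
continuous nowhere-zero section is cut out, in an open neighbourhood, by a smooth `ℂ`-valued submersion.
[cite: Kirby1989, Ch. VIII, Thm. 2] -/
theorem helper_nwtEndgame : ∀ (m : ℕ) (X : Type) [TopologicalSpace X] [T2Space X] [ChartedSpace (EuclideanSpace ℝ (Fin 4)) X] [IsManifold (𝓡 4) ∞ X] (D : Literature.Topology.FourManifolds.CodimTwoData 2 X (Literature.Topology.FourManifolds.ComplexProjectiveSpace 1) (EuclideanSpace ℝ (Fin m))) (s₀ : Literature.Topology.FourManifolds.ComplexProjectiveSpace 1 → EuclideanSpace ℝ (Fin m)), Continuous s₀ → (∀ y, D.Q y (s₀ y) = s₀ y ∧ s₀ y ≠ 0) → ∃ (N' : Set X) (π' : X → ℂ), IsOpen N' ∧ Set.range D.b ⊆ N' ∧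 ContMDiffOn (𝓡 4) 𝓘(ℝ, ℂ) ∞ π' N' ∧ (∀ y ∈ N', Function.Surjective (mfderiv (𝓡 4) 𝓘(ℝ, ℂ) π' y)) ∧ {y | y ∈ N' ∧ π' y = 0} = Set.range D.b := by
  intro m X _ _ _ _ D s₀ hs₀c hs₀
  -- rotation field, smooth section, framing, framed tube
  obtain ⟨J, hJ⟩ := D.exists_isRotationField_projectiveLine
  obtain ⟨s, hs, hsQ⟩ := D.exists_contMDiff_normalSection_of_continuous hs₀c hs₀
  obtain ⟨N, hN, hbij⟩ := D.exists_isSmoothAlong_of_normalSection hJ hs hsQ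
  obtain ⟨ν, hν, hνo, hν0⟩ :=
    exists_isSmoothEmbedding_tube_of_isSmoothAlong (IM := 𝓡 2) (F := EuclideanSpace ℝ (Fin 2)) D.hb D.hbinj hN hbij
  -- `ν` is an injective local diffeomorphism
  have hνs : ContMDiff ((𝓡 2).prod 𝓘(ℝ, EuclideanSpace ℝ (Fin 2))) (𝓡 4) ∞ ν := hν.contMDiff
  have hνinj : Injective ν := hν.isEmbedding.injective
  have hdim : Module.finrank ℝ (EuclideanSpace ℝ (Fin 2) × EuclideanSpace ℝ (Fin 2)) =
      Module.finrank ℝ (EuclideanSpace ℝ (Fin 4)) := by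
    rw [Module.finrank_prod, finrank_euclideanSpace_fin, finrank_euclideanSpace_fin]
  have hνd : ∀ q, Bijective (mfderiv ((𝓡 2).prod 𝓘(ℝ, EuclideanSpace ℝ (Fin 2))) (𝓡 4) ν q) := by
    intro q
    have hinj := injective_mfderiv_of_isImmersionAt' (hν.isImmersion.isImmersionAt q)
    exact bijective_of_injective_four hdim
      (mfderiv ((𝓡 2).prod 𝓘(ℝ, EuclideanSpace ℝ (Fin 2))) (𝓡 4) ν q).toLinearMap hinj
  -- the inverse on the (open) range
  set g : X → Literature.Topology.FourManifolds.ComplexProjectiveSpace 1 × EuclideanSpace ℝ (Fin 2) :=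
    invFunOn ν univ with hgdef
  have himg : ν '' univ = range ν := image_univ
  have hg_smooth : ContMDiffOn (𝓡 4) ((𝓡 2).prod 𝓘(ℝ, EuclideanSpace ℝ (Fin 2))) ∞ g (range ν) := by
    rw [← himg]
    exact Literature.Geometry.Manifold.contMDiffOn_invFunOn_of_bijective_mfderiv isOpen_univ
      hνs.contMDiffOn hνinj.injOn (fun q _ => hνd q)
  have hg_left : ∀ q, g (ν q) = q := fun q =>
    Literature.Geometry.Manifold.invFunOn_apply hνinj.injOn (mem_univ q)
  have hgd : ∀ q, Bijective (mfderiv (𝓡 4) ((𝓡 2).prod 𝓘(ℝ, EuclideanSpace ℝ (Fin 2))) g (ν q)) :=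
    fun q => Literature.Geometry.Manifold.bijective_mfderiv_invFunOn isOpen_univ hνs.contMDiffOn
      hνinj.injOn (fun q _ => hνd q) (mem_univ q)
  -- the witness
  let T : EuclideanSpace ℝ (Fin 2) →L[ℝ] ℂ :=
    (Complex.orthonormalBasisOneI.repr.symm.toContinuousLinearEquiv : EuclideanSpace ℝ (Fin 2) →L[ℝ] ℂ)
  have hTinj : Injective T := Complex.orthonormalBasisOneI.repr.symm.injective
  have hTsurj : Surjective T := Complex.orthonormalBasisOneI.repr.symm.surjective
  let π' : X → ℂ := fun y => T (g y).2
  have hTs : ContMDiff ((𝓡 2).prod 𝓘(ℝ, EuclideanSpace ℝ (Fin 2))) 𝓘(ℝ, ℂ) ∞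
      (fun p : Literature.Topology.FourManifolds.ComplexProjectiveSpace 1 × EuclideanSpace ℝ (Fin 2) => T p.2) :=
    T.contMDiff.comp contMDiff_snd
  refine ⟨range ν, π', hνo, ?_, hTs.comp_contMDiffOn hg_smooth, ?_, ?_⟩
  · rintro _ ⟨x, rfl⟩
    exact ⟨(x, 0), hν0 x⟩
  · rintro _ ⟨q, rfl⟩
    have h1 : HasMFDerivAt ((𝓡 2).prod 𝓘(ℝ, EuclideanSpace ℝ (Fin 2))) 𝓘(ℝ, ℂ)
        (fun p : Literature.Topology.FourManifolds.ComplexProjectiveSpace 1 × EuclideanSpace ℝ (Fin 2) => T p.2)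
        (g (ν q)) (T.comp (ContinuousLinearMap.snd ℝ (EuclideanSpace ℝ (Fin (2 * 1))) (EuclideanSpace ℝ (Fin 2)))) :=
      T.hasMFDerivAt.comp (g (ν q)) (hasMFDerivAt_snd _)
    have h2 : MDifferentiableAt (𝓡 4) ((𝓡 2).prod 𝓘(ℝ, EuclideanSpace ℝ (Fin 2))) g (ν q) :=
      (hg_smooth.contMDiffAt (hνo.mem_nhds ⟨q, rfl⟩)).mdifferentiableAt (by simp)
    have h3 : HasMFDerivAt (𝓡 4) 𝓘(ℝ, ℂ) π' (ν q)
        ((T.comp (ContinuousLinearMap.snd ℝ (EuclideanSpace ℝ (Fin (2 * 1))) (EuclideanSpace ℝ (Fin 2)))).comp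
          (mfderiv (𝓡 4) ((𝓡 2).prod 𝓘(ℝ, EuclideanSpace ℝ (Fin 2))) g (ν q))) :=
      h1.comp (ν q) h2.hasMFDerivAt
    rw [h3.mfderiv]
    intro c
    obtain ⟨e, he⟩ := hTsurj c
    obtain ⟨w, hw⟩ := (hgd q).2 ((0 : EuclideanSpace ℝ (Fin (2 * 1))), e)
    refine ⟨w, ?_⟩
    show T ((mfderiv (𝓡 4) ((𝓡 2).prod 𝓘(ℝ, EuclideanSpace ℝ (Fin 2))) g (ν q)) w).2 = c
    rw [hw]
    exact he
  · ext y
    simp only [mem_setOf_eq, mem_range]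
    constructor
    · rintro ⟨⟨q, rfl⟩, h0⟩
      have hq2 : (g (ν q)).2 = 0 := hTinj (by rw [map_zero]; exact h0)
      rw [hg_left] at hq2
      refine ⟨q.1, ?_⟩
      rw [← hν0]
      obtain ⟨q1, q2⟩ := q
      simp only at hq2
      rw [hq2]
    · rintro ⟨x, rfl⟩
      refine ⟨⟨(x, 0), hν0 x⟩, ?_⟩
      show T (g (D.b x)).2 = 0
      rw [← hν0 x, hg_left]
      exact map_zero T

end Summit.SmoothPoincare4.SmoothPoincare4.Theorems.GromovRecognitionRelEnd.CrossCapLaurent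

end
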